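/- Width seat `ym-line-cbag-p1-w2` (prover-ym-line-cbag-p1-w2-g14-0) on the planner-of-record's LINE 5, route `HankelDensitySplitting`:
helper for REGISTERED STUB B `stub_freeKernelMargin` of the birth skeleton v2 of crux `LogWindowMixedDominance` (stmt-QuantumFields-26617).
Pure real analysis; RECORD-type material (node `LatticeNonFreezing`); the Yang–Mills mass gap is NOT proved by anything here. -/
import Summits.QuantumFields.YangMills.Theorems.EquipartitionCriticalityEquipartitionPinsProbeProfile
import Literature.Probability.LatticeModels.LatticeGreenFunction
import Literature.Analysis.Fourier.CharFunHalfPlaneSupport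
import HarnessLib

/-!
# Preliminaries for the decay of the `d = 4` lattice Green function: the transfer-matrix ratio and cube integrals

Support file for crux `LogWindowMixedDominance` (stmt-QuantumFields-26617), stub B `FreeKernelMargin`.  Elementary real analysis for the
mixed representation `latticeGreen (n, x) = (2π)⁻³ ∫_{[-π,π]³} cos(k·x) r(ε₃(k))^{|n|}/√(ε₃(ε₃+2)) dk` (`LogWindowMixedDominanceGreenMixedRepr`):

* the ratio `r(ε) = 1 + ε − √(ε(ε+2)) ∈ (0, 1]` (`= e^{−ω}`, `cosh ω = 1 + ε`) and the weight `1/√(ε(ε+2))` on the Brillouin zone `[-π,π]³`: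
  `0 ≤ 1 − r ≤ √(ε(ε+2)) ≤ 7‖k‖`, `(2/π)‖k‖ ≤ √(ε(ε+2))`, and the exponential bound `r(ε₃(k)) ≤ exp(−(2/(3π))‖k‖)`
  (`‖·‖` the sup norm; from `ε ≥ (2/π²)‖k‖²`, `r = 1/(1 + ε + √(ε(ε+2))) ≤ 1/(1 + (2/π)‖k‖)` and `1/(1+y) ≤ e^{−y/3}` for `y ≤ 2`);
* cube integrals: `∫_{[-π,π]³} e^{−a‖k‖} dk ≤ (6/a)³`, `∫ ‖k‖ e^{−a‖k‖} ≤ (2/a)(12/a)³`, `∫ ‖k‖² e^{−a‖k‖} ≤ (4/a)²(12/a)³` (`a > 0`), by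
  `e^{−a‖k‖} ≤ ∏ᵢ e^{−(a/3)|kᵢ|}`, Fubini on the cube and `∫_{-π}^{π} e^{−b|t|} dt ≤ 2/b`.

[folklore]; no rung or summit statement is proved here.
-/

set_option autoImplicit false

noncomputable section

namespace Summit.QuantumFields.YangMills.Theorems.HankelDensitySplitting.LogWindow

namespace GreenDecay

open Real MeasureTheory Set Literature.Probability.LatticeModels
open Summit.QuantumFields.YangMills.Theorems.EquipartitionPinsProbe.Profile (ratio_pos ratio_le_one)

/-! ### The ratio `r(ε) = 1 + ε − √(ε(ε+2))` and the weight `1/√(ε(ε+2))` -/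

/-- `0 ≤ 1 − r(ε)` for `ε ≥ 0`. -/
theorem one_sub_ratio_nonneg {x : ℝ} (hx : 0 ≤ x) : 0 ≤ 1 - (1 + x - Real.sqrt (x * (x + 2))) := by
  linarith [ratio_le_one hx]

/-- `1 − r(ε) ≤ √(ε(ε+2))` for `ε ≥ 0` (indeed `1 − r = √(ε(ε+2)) − ε`). -/
theorem one_sub_ratio_le_sqrt {x : ℝ} (hx : 0 ≤ x) :
    1 - (1 + x - Real.sqrt (x * (x + 2))) ≤ Real.sqrt (x * (x + 2)) := by
  linarith

/-- `r(ε) · (1 + ε + √(ε(ε+2))) = 1` for `ε ≥ 0`. -/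
theorem ratio_mul_conj {x : ℝ} (hx : 0 ≤ x) :
    (1 + x - Real.sqrt (x * (x + 2))) * (1 + x + Real.sqrt (x * (x + 2))) = 1 := by
  have h : Real.sqrt (x * (x + 2)) ^ 2 = x * (x + 2) := Real.sq_sqrt (by positivity)
  nlinarith [h]

/-- `r(ε) ≤ 1/(1 + √(ε(ε+2)))` for `ε ≥ 0`. -/
theorem ratio_le_inv {x : ℝ} (hx : 0 ≤ x) :
    1 + x - Real.sqrt (x * (x + 2)) ≤ 1 / (1 + Real.sqrt (x * (x + 2))) := by
  have hs : 0 ≤ Real.sqrt (x * (x + 2)) := Real.sqrt_nonneg _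
  rw [le_div_iff₀ (by positivity)]
  have h := ratio_mul_conj hx
  have hr : 0 ≤ 1 + x - Real.sqrt (x * (x + 2)) := (ratio_pos hx).le
  nlinarith [mul_nonneg hr hx]

/-- On the Brillouin zone: `(2/π)‖k‖ ≤ √(ε₃(k)(ε₃(k)+2))` (from `ε ≥ (2/π²)‖k‖²`). -/
theorem norm_le_sqrt {k : Fin 3 → ℝ} (hk : k ∈ brillouin 3) :
    2 / π * ‖k‖ ≤ Real.sqrt (dispersion k * (dispersion k + 2)) := by
  have hε := mul_norm_sq_le_dispersion hk
  have hε0 := dispersion_nonneg k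
  have hπ := Real.pi_pos
  have h0 : 0 ≤ 2 / π * ‖k‖ := by positivity
  rw [Real.le_sqrt h0 (by positivity)]
  have e : (2 / π * ‖k‖) ^ 2 = 2 * (2 / π ^ 2 * ‖k‖ ^ 2) := by ring
  rw [e]
  nlinarith

/-- On the Brillouin zone: `ε₃(k) ≤ (3/2)‖k‖²` (`1 − cos t ≤ t²/2`, `|kᵢ| ≤ ‖k‖`). -/
theorem dispersion_le_norm_sq (k : Fin 3 → ℝ) : dispersion k ≤ 3 / 2 * ‖k‖ ^ 2 := by
  have hterm : ∀ i : Fin 3, 1 - Real.cos (k i) ≤ ‖k‖ ^ 2 / 2 := fun i => by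
    have h1 := Real.one_sub_sq_div_two_le_cos (x := k i)
    have h2 : (k i) ^ 2 ≤ ‖k‖ ^ 2 := by
      rw [← sq_abs]
      exact pow_le_pow_left₀ (abs_nonneg _) (by simpa only [Real.norm_eq_abs] using norm_le_pi_norm k i) 2
    linarith
  calc dispersion k = ∑ i : Fin 3, (1 - Real.cos (k i)) := rfl
    _ ≤ ∑ _i : Fin 3, ‖k‖ ^ 2 / 2 := Finset.sum_le_sum fun i _ => hterm i
    _ = 3 / 2 * ‖k‖ ^ 2 := by
      simp only [Finset.sum_const, Finset.card_univ, Fintype.card_fin, nsmul_eq_mul]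
      ring

/-- On the Brillouin zone: `√(ε₃(k)(ε₃(k)+2)) ≤ 7‖k‖`. -/
theorem sqrt_le_norm {k : Fin 3 → ℝ} (hk : k ∈ brillouin 3) :
    Real.sqrt (dispersion k * (dispersion k + 2)) ≤ 7 * ‖k‖ := by
  have hε := dispersion_le_norm_sq k
  have hε0 := dispersion_nonneg k
  have hkπ : ‖k‖ ≤ π := by
    refine (pi_norm_le_iff_of_nonneg Real.pi_pos.le).2 fun i => ?_
    rw [Real.norm_eq_abs]
    exact abs_le.2 (hk i (Set.mem_univ _))
  have hπ4 : π ≤ 4 := by linarith [Real.pi_lt_four]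
  have hk0 : 0 ≤ ‖k‖ := norm_nonneg _
  have hk16 : ‖k‖ ^ 2 ≤ 16 := by nlinarith
  have h26 : dispersion k + 2 ≤ 26 := by linarith
  rw [Real.sqrt_le_left (by positivity)]
  have hprod := mul_le_mul hε h26 (by positivity) (by positivity)
  nlinarith [sq_nonneg ‖k‖]

/-- `1/(1+y) ≤ exp(−y/3)` for `0 ≤ y ≤ 2`. -/
theorem inv_one_add_le_exp {y : ℝ} (h0 : 0 ≤ y) (h2 : y ≤ 2) : 1 / (1 + y) ≤ Real.exp (-(y / 3)) := by
  have h1 : 1 / (1 + y) ≤ Real.exp (-(y / (1 + y))) := by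
    have := Real.add_one_le_exp (-(y / (1 + y)))
    have e : -(y / (1 + y)) + 1 = 1 / (1 + y) := by field_simp; ring
    linarith [e]
  refine h1.trans (Real.exp_le_exp.2 ?_)
  rw [neg_le_neg_iff, div_le_div_iff₀ (by norm_num) (by positivity)]
  nlinarith

/-- **Exponential bound on the transfer-matrix ratio on the Brillouin zone**: `r(ε₃(k)) ≤ exp(−(2/(3π))‖k‖)`. -/
theorem ratio_le_exp {k : Fin 3 → ℝ} (hk : k ∈ brillouin 3) :
    1 + dispersion k - Real.sqrt (dispersion k * (dispersion k + 2)) ≤ Real.exp (-(2 / (3 * π) * ‖k‖)) := by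
  have hε0 := dispersion_nonneg k
  have hs := norm_le_sqrt hk
  have hkπ : ‖k‖ ≤ π := by
    refine (pi_norm_le_iff_of_nonneg Real.pi_pos.le).2 fun i => ?_
    rw [Real.norm_eq_abs]
    exact abs_le.2 (hk i (Set.mem_univ _))
  have hπ := Real.pi_pos
  have hy0 : 0 ≤ 2 / π * ‖k‖ := by positivity
  have hy2 : 2 / π * ‖k‖ ≤ 2 := by
    rw [div_mul_eq_mul_div, div_le_iff₀ hπ]
    nlinarith
  calc 1 + dispersion k - Real.sqrt (dispersion k * (dispersion k + 2))
      ≤ 1 / (1 + Real.sqrt (dispersion k * (dispersion k + 2))) := ratio_le_inv hε0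
    _ ≤ 1 / (1 + 2 / π * ‖k‖) := one_div_le_one_div_of_le (by positivity) (by linarith)
    _ ≤ Real.exp (-(2 / π * ‖k‖ / 3)) := inv_one_add_le_exp hy0 hy2
    _ = Real.exp (-(2 / (3 * π) * ‖k‖)) := by
      congr 1
      field_simp

/-- Powers: `r(ε₃(k))ⁿ ≤ exp(−(2/(3π)) n ‖k‖)` on the Brillouin zone. -/
theorem ratio_pow_le_exp {k : Fin 3 → ℝ} (hk : k ∈ brillouin 3) (n : ℕ) :
    (1 + dispersion k - Real.sqrt (dispersion k * (dispersion k + 2))) ^ n ≤ Real.exp (-(2 / (3 * π) * n * ‖k‖)) := by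
  calc (1 + dispersion k - Real.sqrt (dispersion k * (dispersion k + 2))) ^ n
      ≤ Real.exp (-(2 / (3 * π) * ‖k‖)) ^ n := pow_le_pow_left₀ (ratio_pos (dispersion_nonneg k)).le (ratio_le_exp hk) n
    _ = Real.exp (-(2 / (3 * π) * n * ‖k‖)) := by
      rw [← Real.exp_nat_mul]
      congr 1
      ring

/-! ### Elementary bound `u² e^{−au} ≤ (4/a)² e^{−au/2}` (the linear one is `Literature.Analysis.Fourier.mul_exp_neg_le_exp_half`) -/

/-- `u² · e^{−a u} ≤ (4/a)² · e^{−(a/2) u}` for `u ≥ 0`, `a > 0`. -/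
theorem sq_mul_exp_le {u a : ℝ} (hu : 0 ≤ u) (ha : 0 < a) :
    u ^ 2 * Real.exp (-(a * u)) ≤ (4 / a) ^ 2 * Real.exp (-(a / 2 * u)) := by
  have h1 : a / 4 * u ≤ Real.exp (a / 4 * u) := by
    have := Real.add_one_le_exp (a / 4 * u)
    linarith
  have h2 : u ≤ 4 / a * Real.exp (a / 4 * u) := by
    rw [div_mul_eq_mul_div, le_div_iff₀ ha]
    linarith
  have h2' : u ^ 2 ≤ (4 / a * Real.exp (a / 4 * u)) ^ 2 := pow_le_pow_left₀ hu h2 2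
  have h3 : (4 / a * Real.exp (a / 4 * u)) ^ 2 * Real.exp (-(a * u)) = (4 / a) ^ 2 * Real.exp (-(a / 2 * u)) := by
    rw [mul_pow, ← Real.exp_nat_mul, mul_assoc, ← Real.exp_add]
    congr 2
    push_cast
    ring
  calc u ^ 2 * Real.exp (-(a * u)) ≤ (4 / a * Real.exp (a / 4 * u)) ^ 2 * Real.exp (-(a * u)) :=
        mul_le_mul_of_nonneg_right h2' (Real.exp_nonneg _)
    _ = (4 / a) ^ 2 * Real.exp (-(a / 2 * u)) := h3

/-! ### Cube integrals -/

/-- `∫_{[-π,π]} e^{−b|t|} dt ≤ 2/b` for `b > 0` (both halves are `(1 − e^{−bπ})/b`). -/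
theorem integral_exp_neg_mul_abs_le {b : ℝ} (hb : 0 < b) :
    ∫ t in Icc (-π) π, Real.exp (-(b * |t|)) ≤ 2 / b := by
  have hππ : -π ≤ π := by linarith [Real.pi_pos]
  have hπ0 : (0 : ℝ) ≤ π := Real.pi_pos.le
  have hb0 : b ≠ 0 := hb.ne'
  have hc : Continuous fun t : ℝ => Real.exp (-(b * |t|)) := by fun_prop
  rw [integral_Icc_eq_integral_Ioc, ← intervalIntegral.integral_of_le hππ,
    ← intervalIntegral.integral_add_adjacent_intervals (b := 0) (hc.intervalIntegrable _ _)
      (hc.intervalIntegrable _ _)]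
  -- right half
  have hR : ∫ t in (0 : ℝ)..π, Real.exp (-(b * |t|)) = ∫ t in (0 : ℝ)..π, Real.exp (-(b * t)) := by
    refine intervalIntegral.integral_congr fun t ht => ?_
    rw [Set.uIcc_of_le hπ0] at ht
    simp only [abs_of_nonneg ht.1]
  have hR' : ∫ t in (0 : ℝ)..π, Real.exp (-(b * t)) =
      Real.exp (-(b * π)) * (-1 / b) - Real.exp (-(b * 0)) * (-1 / b) := by
    refine intervalIntegral.integral_eq_sub_of_hasDerivAt (f := fun t => Real.exp (-(b * t)) * (-1 / b)) ?_
      (Continuous.intervalIntegrable (by fun_prop) _ _)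
    intro t _
    have h1 : HasDerivAt (fun s : ℝ => -(b * s)) (-b) t := by
      have h := (hasDerivAt_id t).const_mul (-b)
      simpa [neg_mul] using h
    have h3 := h1.exp.mul_const (-1 / b)
    exact h3.congr_deriv (by field_simp)
  -- left half
  have hL : ∫ t in (-π)..(0 : ℝ), Real.exp (-(b * |t|)) = ∫ t in (-π)..(0 : ℝ), Real.exp (b * t) := by
    refine intervalIntegral.integral_congr fun t ht => ?_
    rw [Set.uIcc_of_le (by linarith)] at ht
    simp only [abs_of_nonpos ht.2, mul_neg, neg_neg]
  have hL' : ∫ t in (-π)..(0 : ℝ), Real.exp (b * t) = Real.exp (b * 0) * (1 / b) - Real.exp (b * (-π)) * (1 / b) := by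
    refine intervalIntegral.integral_eq_sub_of_hasDerivAt (f := fun t => Real.exp (b * t) * (1 / b)) ?_
      (Continuous.intervalIntegrable (by fun_prop) _ _)
    intro t _
    have h1 : HasDerivAt (fun s : ℝ => b * s) b t := by
      simpa using (hasDerivAt_id t).const_mul b
    have h3 := h1.exp.mul_const (1 / b)
    exact h3.congr_deriv (by field_simp)
  rw [hR, hR', hL, hL']
  simp only [mul_zero, neg_zero, Real.exp_zero, one_mul]
  have h1 : 0 ≤ Real.exp (b * -π) * (1 / b) := by positivity
  have h2 : 0 ≤ Real.exp (-(b * π)) * (1 / b) := by positivity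
  have e : 1 / b - Real.exp (b * -π) * (1 / b) + (Real.exp (-(b * π)) * (-1 / b) - -1 / b) =
      2 / b - (Real.exp (b * -π) * (1 / b) + Real.exp (-(b * π)) * (1 / b)) := by ring
  rw [e]
  linarith

/-- The cube integral of a coordinatewise product: `∫_{[-π,π]³} ∏ᵢ g(kᵢ) dk = (∫_{[-π,π]} g)³`. -/
theorem setIntegral_brillouin_prod (g : ℝ → ℝ) :
    ∫ k in brillouin 3, ∏ i : Fin 3, g (k i) = (∫ t in Icc (-π) π, g t) ^ 3 := by
  have h : (volume : Measure (Fin 3 → ℝ)).restrict (brillouin 3) =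
      Measure.pi fun _ : Fin 3 => (volume : Measure ℝ).restrict (Icc (-π) π) := by
    rw [volume_pi]
    exact Measure.restrict_pi_pi (μ := fun _ : Fin 3 => (volume : Measure ℝ)) (fun _ : Fin 3 => Icc (-π) π)
  rw [h, integral_fintype_prod_eq_pow (ι := Fin 3) (μ := (volume : Measure ℝ).restrict (Icc (-π) π)) g]
  simp

/-- **`∫_{[-π,π]³} e^{−a‖k‖} dk ≤ (6/a)³`** (`a > 0`, sup norm). -/
theorem setIntegral_exp_neg_norm_le {a : ℝ} (ha : 0 < a) :
    ∫ k in brillouin 3, Real.exp (-(a * ‖k‖)) ≤ (6 / a) ^ 3 := by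
  have hpt : ∀ k : Fin 3 → ℝ, Real.exp (-(a * ‖k‖)) ≤ ∏ i : Fin 3, Real.exp (-(a / 3 * |k i|)) := by
    intro k
    rw [← Real.exp_sum, Real.exp_le_exp]
    have hi : ∀ i : Fin 3, |k i| ≤ ‖k‖ := fun i => by simpa only [Real.norm_eq_abs] using norm_le_pi_norm k i
    simp only [Fin.sum_univ_three]
    nlinarith [hi 0, hi 1, hi 2]
  have hcont1 : Continuous fun k : Fin 3 → ℝ => Real.exp (-(a * ‖k‖)) := by fun_prop
  have hcont2 : Continuous fun k : Fin 3 → ℝ => ∏ i : Fin 3, Real.exp (-(a / 3 * |k i|)) := by fun_prop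
  calc ∫ k in brillouin 3, Real.exp (-(a * ‖k‖))
      ≤ ∫ k in brillouin 3, ∏ i : Fin 3, Real.exp (-(a / 3 * |k i|)) :=
        setIntegral_mono (hcont1.continuousOn.integrableOn_compact (isCompact_brillouin 3))
          (hcont2.continuousOn.integrableOn_compact (isCompact_brillouin 3)) hpt
    _ = (∫ t in Icc (-π) π, Real.exp (-(a / 3 * |t|))) ^ 3 := setIntegral_brillouin_prod fun t => Real.exp (-(a / 3 * |t|))
    _ ≤ (2 / (a / 3)) ^ 3 := by
        refine pow_le_pow_left₀ (setIntegral_nonneg measurableSet_Icc fun t _ => (Real.exp_pos _).le) ?_ 3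
        exact integral_exp_neg_mul_abs_le (by positivity)
    _ = (6 / a) ^ 3 := by
        congr 1
        field_simp
        norm_num

/-- **`∫_{[-π,π]³} ‖k‖ e^{−a‖k‖} dk ≤ (2/a)(12/a)³`** (`a > 0`). -/
theorem setIntegral_norm_mul_exp_le {a : ℝ} (ha : 0 < a) :
    ∫ k in brillouin 3, ‖k‖ * Real.exp (-(a * ‖k‖)) ≤ 2 / a * (12 / a) ^ 3 := by
  have hpt : ∀ k : Fin 3 → ℝ, ‖k‖ * Real.exp (-(a * ‖k‖)) ≤ 2 / a * Real.exp (-(a / 2 * ‖k‖)) :=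
    fun k => Literature.Analysis.Fourier.mul_exp_neg_le_exp_half ‖k‖ ha
  have hcont1 : Continuous fun k : Fin 3 → ℝ => ‖k‖ * Real.exp (-(a * ‖k‖)) := by fun_prop
  have hcont2 : Continuous fun k : Fin 3 → ℝ => 2 / a * Real.exp (-(a / 2 * ‖k‖)) := by fun_prop
  calc ∫ k in brillouin 3, ‖k‖ * Real.exp (-(a * ‖k‖))
      ≤ ∫ k in brillouin 3, 2 / a * Real.exp (-(a / 2 * ‖k‖)) :=
        setIntegral_mono (hcont1.continuousOn.integrableOn_compact (isCompact_brillouin 3))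
          (hcont2.continuousOn.integrableOn_compact (isCompact_brillouin 3)) hpt
    _ = 2 / a * ∫ k in brillouin 3, Real.exp (-(a / 2 * ‖k‖)) := integral_const_mul _ _
    _ ≤ 2 / a * (6 / (a / 2)) ^ 3 :=
        mul_le_mul_of_nonneg_left (setIntegral_exp_neg_norm_le (by positivity)) (by positivity)
    _ = 2 / a * (12 / a) ^ 3 := by
        congr 2
        field_simp
        norm_num

/-- **`∫_{[-π,π]³} ‖k‖² e^{−a‖k‖} dk ≤ (4/a)²(12/a)³`** (`a > 0`). -/
theorem setIntegral_norm_sq_mul_exp_le {a : ℝ} (ha : 0 < a) :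
    ∫ k in brillouin 3, ‖k‖ ^ 2 * Real.exp (-(a * ‖k‖)) ≤ (4 / a) ^ 2 * (12 / a) ^ 3 := by
  have hpt : ∀ k : Fin 3 → ℝ, ‖k‖ ^ 2 * Real.exp (-(a * ‖k‖)) ≤ (4 / a) ^ 2 * Real.exp (-(a / 2 * ‖k‖)) :=
    fun k => sq_mul_exp_le (norm_nonneg k) ha
  have hcont1 : Continuous fun k : Fin 3 → ℝ => ‖k‖ ^ 2 * Real.exp (-(a * ‖k‖)) := by fun_prop
  have hcont2 : Continuous fun k : Fin 3 → ℝ => (4 / a) ^ 2 * Real.exp (-(a / 2 * ‖k‖)) := by fun_prop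
  calc ∫ k in brillouin 3, ‖k‖ ^ 2 * Real.exp (-(a * ‖k‖))
      ≤ ∫ k in brillouin 3, (4 / a) ^ 2 * Real.exp (-(a / 2 * ‖k‖)) :=
        setIntegral_mono (hcont1.continuousOn.integrableOn_compact (isCompact_brillouin 3))
          (hcont2.continuousOn.integrableOn_compact (isCompact_brillouin 3)) hpt
    _ = (4 / a) ^ 2 * ∫ k in brillouin 3, Real.exp (-(a / 2 * ‖k‖)) := integral_const_mul _ _
    _ ≤ (4 / a) ^ 2 * (6 / (a / 2)) ^ 3 :=
        mul_le_mul_of_nonneg_left (setIntegral_exp_neg_norm_le (by positivity)) (by positivity)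
    _ = (4 / a) ^ 2 * (12 / a) ^ 3 := by
        congr 2
        field_simp
        norm_num

end GreenDecay

end Summit.QuantumFields.YangMills.Theorems.HankelDensitySplitting.LogWindow

end
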